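import Mathlib
import Literature.MathematicalPhysics.QuantumFieldTheory.Balaban1983to89.B6DomainMajorantSandwichProfile
import Literature.MathematicalPhysics.QuantumFieldTheory.Balaban1983to89.B6Prop23Assembled

/-!
# `Balaban1983to89.B6Prop23DomainInput` — p. 238 before (2.85): the change-of-domain INPUT `hdom` of the
assembled Proposition 2.3 (`B6Prop23Assembled.prop23_assembled`) DERIVED from the fine-lattice line-3 chain
(`B6DomainMajorantSandwichProfile.line3_term_entry_le_profile`) — the junction "kernels of (2.69) ↔ operators
Q′G′²Q′*, Q′G′(□̃)²Q′* on the blocks"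

B6 = T. Bałaban, *Propagators and renormalization transformations for lattice gauge theories. II*, Commun. Math. Phys.
**96**, 223–250 (1984) [Balaban1984PropagatorsII].

CITATION HEADER (lean-in-tree rule 2026-08-18).  Cell `pub-balaban`, unit `b2b-balaban-b06-g12` (paper sub-cell B06,
gen 12 — the owner lineage of `…B6DomainMajorant[Sandwich[Profile]]`, `…B6Expansion282`, `…B6Prop23Chain`,
`…B6Prop23Assembled`, `…B6Prop23Printed`).  Imports: Mathlib + `…B6DomainMajorantSandwichProfile` (p184736) +
`…B6Prop23Assembled` (p184501/p184659); nothing landed is modified.  Source: doi:10.1007/bf01240221, held `paper:balaban1984-cmp96-propagators-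
rt-ii`; journal page = PDF page + 222; p. 238 [PDF 16] read from the render `b2b-balaban-ref1/pages/1984-cmp96-
propagators-rt-II/1984-cmp96-propagators-rt-II-p016-x2.png` AS AN IMAGE (OCR `p0016.txt` l.2–6 agrees).  Cell rows GAPS
C-b06g12-7, DIVERGENCE D-b06.28; journal claim PROP23-DOMAIN-INPUT; design note `HOME/b2b-balaban-b06-g12/SUCCESSOR-
DESIGN-hdom-discharge.md` (steps 1–2; its dictionary facts pre-checked in `design_check.lean`).

THE PRINTED TEXT.  p. 238, verbatim: *"Similar inequalities hold for kernels of the other operators forming R, for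
example the operator with G′(□̃)² − G′² is small and an estimate has the factor e^{−δ₀M} because of the usual estimate
of the type (1.12) [3] connected with a change of a domain. This estimate follows from the random walk
representations (2.50) for the operators G′, G′(□̃)."*  In the assembled Proposition 2.3 this sentence is the
HYPOTHESIS `hdom` of `B6Prop23Assembled.prop23_assembled` (per cube □ = `pf i`, h_□ = `hf i`, kernels X, X̃_□ = `Xw i` in
the pairing (2.69), w(y″) = (L^{j″}η)^d):
  `|pf i y * (len y″ ^ d * (Xw i y y″ − X y y″)) * hf i y″| ≤ B_D·e^{−c₃M}·(len y)⁴·e^{−½δ₀d(y,y″)}`.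
On the fine-lattice side the lineage proves (`…B6DomainMajorantSandwichProfile`, p184736) the kernel bound for the
OPERATOR `□Q′(G′(□̃)² − G′²)Q′*h_□` on 𝔅: `|entry (…) y y″| ≤ c_Qc_{Q*}·(L²(len y²)²C_tot·e^{−((δ−α′δ₀)/3)M₀}·
e^{−((δ−α′δ₀)/6)d(y,y″)})` under ITS located inputs ((2.60), an abstract (2.61) profile, the cut algebra of □̃, the
majorants of G′, G′(□̃) and of the commutator products, the depth M₀ of □ and supp h_□ inside the region χ = 1).

THE DICTIONARY (this module).  (a) `B9Thm34Inv.entry` = `B6Prop23Chain.mat` and `B9Thm37Sum.mulOp` =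
`B6Expansion282.mulOp` definitionally (`entry_eq_mat`, `mulOp_eq_mulOp`: `rfl`); (b) the kernels of (2.69) are READ OFF
the block operators: the hypotheses `hX : kerOp w X = Q′ ∘ (G′·G′) ∘ Q′*` and `hXw : kerOp w X̃_□ = Q′ ∘ (G′(□̃)·G′(□̃)) ∘
Q′*` (for w > 0 every operator on the finite 𝔅 is `kerOp w` of its normalised matrix — `kerOp_mat_div`, so these are
definitions of X, X̃_□ in operator clothing, not extra assumptions), whence `w(y″)(X̃_□ − X)(y, y″) = mat(Q′(G′(□̃)² −
G′²)Q′*)(y, y″)` and `□(y)·(…)·h_□(y″) = entry(□·Q′(…)Q′*·h_□)(y, y″)` (`sandwich_entry_eq`); (c) the RATE KNOB: the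
δ₀ of `prop23_assembled` is a free rate name, instantiated here as δ₀_asm := (δ − α′δ₀)/3 so that ½δ₀_asm is the
fine chain's rate (δ − α′δ₀)/6; (d) constants: B_D := c_Qc_{Q*}·L²·C_tot, and the depth enters through
`hM₀ : c₃·M ≤ ((δ − α′δ₀)/3)·M₀` (the paper's □̃ is built from M-big blocks, so M₀ ≍ const·M, p. 238 *"4d big blocks
(of the size M …)"*); (e) instantiation note: `C_tot K` reads the profile only at the rates (δ − α′δ₀)/6 and (δ − α′δ₀)/3
(`B6DomainMajorant.Ctot`), so with r1's `B9SectCDiffFrame.profile_of_ineq261With` (K = `profileW g c δ₀ α`, generic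
constant c of the repaired Lemma 2.1) the volume-free value max c 1 is what enters iff αδ₀ ≤ (δ − α′δ₀)/6
(`profileW_of_le`); below that rate `profileW` is the trivial count max |𝔅| 1.

WHAT THIS MODULE PROVES (kernel-checked; no `sorry`, no axiom beyond Lean's three; bookkeeping only):
1. `entry_eq_mat`, `mulOp_eq_mulOp`, `eq_of_mat_eq` (operators with equal matrices are equal), `kerOp_mat_div` (every
   operator is `kerOp w` of its w-normalised matrix, w ≠ 0), `mat_kerOp_sub` (w(y″)(X̃ − X)(y,y″) = mat of the operator
   difference), `sandwich_entry_eq` (item (b)).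
2. `hdom_of_line3` — ONE CUBE: the located inputs of `line3_term_entry_le_profile` for the cube's data (sq := □,
   hh := h_□), 0 ≤ c_Q, the dictionary `hX`, `hXw`, and `hM₀` ⟹ the `hdom` inequality for that cube at the rate
   ½·((δ − α′δ₀)/3) with B_D = c_Qc_{Q*}L²C_tot.
3. `hdom_family` — the same over a finite family of cubes i (zone N_i, cut-off χ_i, D_i, G′(□̃_i) = Gw_i indexed by the
   cube; G′, Q′, Q′*, the constants and the depth M₀ common): LITERALLY the binder `hdom` of `prop23_assembled` with
   δ₀ := (δ − α′δ₀)/3, B_D := c_Qc_{Q*}L²C_tot K B₁ θ (δ − α′δ₀).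
4. `prop23_assembled_fine` — PROP. 2.3 RE-ASSEMBLED: `B6Prop23Assembled.prop23_assembled` (two-sided inverse of
   Q′G′²Q′* in the pairing (2.69), the identity (2.86) G = C + G·R, uniqueness, the bound (2.87)) at δ₀ := (δ − α′δ₀)/3,
   B_D := c_Qc_{Q*}L²C_tot, with its hypothesis `hdom` DISCHARGED by `hdom_family`; 0 < δ₀, 0 ≤ B_D, |□| ≤ 1,
   |h_□| ≤ 1 and (2.54) derived here (`abs_le_one_of_zero_or_one`, `abs_le_one_of_sum_sq`, `hρ`).
5. `hdom_of_line3_pt` — non-vacuity of the one-cube junction: `hdom_of_line3` applied on the one-point model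
   (fine lattice = 𝔅 = {pt} = `B6Prop23Assembled.ptGeo`, all operators 1, χ = □ = h_□ = 1, N = {pt}, θ = 0, M₀ = c₃ = 0),
   every hypothesis discharged.  (The re-assembly needs c₃ > 0, hence M₀ > 0 and at least two sites; not modelled.)
WHAT IT DOES NOT PROVE: the located inputs of the fine chain (hypotheses, as in the parents — in particular (2.60),
the (2.61) profile, the majorants of G′, G′(□̃) from (2.50)/(2.67) and of the commutator products, the cut algebra of
□̃); the other two kernel inputs `hX`/`hXw`-majorants of `prop23_assembled` ((2.68), not this module); that M₀ ≍ M for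
the paper's □̃ (it is the hypothesis `hM₀`); the threshold «M large enough» (`hKM`, now with B_D = c_Qc_{Q*}L²C_tot
inside K); a joint consistency model of the re-assembly (two sites needed, see item 5).  Value = the junction
certificate "fine-lattice change-of-domain estimate ⟹ the kernel-form input of the assembled Prop. 2.3" and the
re-assembled Prop. 2.3 with one located hypothesis fewer, NOT summit progress.
-/

namespace Literature.MathematicalPhysics.QuantumFieldTheory.Balaban1983to89.B6Prop23DomainInput

open Finset Real
open B4Sect5Torus (IsPseudoDist)
open B6DomainChange (Profile)
open B6RandomWalk (HasMajorant BlockSupp hasMajorant_mono)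
open B6RandomWalkHom (HasMajorantHom)
open B6DomainMajorant (Ctot Ctot_nonneg)
open B6DomainMajorantSandwichProfile (line3_term_entry_le_profile)
open B6Expansion282 (kerOp kerOp_apply)
open B6Prop23Chain (mat mat_kerOp mat_sub mat_mulOp_mul mat_mul_mulOp)

/-! ## §1  The dictionary: entries, multiplication operators, kernels from operators -/

section Dictionary

variable {S : Type} [Fintype S] [DecidableEq S]

omit [Fintype S] in
/-- The two matrix-entry conventions of the lineage agree definitionally: `B9Thm34Inv.entry T y y′ = T(δ_{y′})(y) =
B6Prop23Chain.mat T y y′`. [folklore] -/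
theorem entry_eq_mat (T : Module.End ℝ (S → ℝ)) (y y' : S) : B9Thm34Inv.entry T y y' = mat T y y' := rfl

omit [Fintype S] [DecidableEq S] in
/-- The two multiplication operators of the lineage agree definitionally. [folklore] -/
theorem mulOp_eq_mulOp (h : S → ℝ) : (B9Thm37Sum.mulOp h : Module.End ℝ (S → ℝ)) = B6Expansion282.mulOp h := rfl

/-- Operators on the functions on a finite set with equal matrices are equal. [folklore] -/
theorem eq_of_mat_eq {T U : Module.End ℝ (S → ℝ)} (h : ∀ y y', mat T y y' = mat U y y') : T = U := by
  refine (Pi.basisFun ℝ S).ext fun y' => ?_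
  funext y
  simpa [mat, Pi.basisFun_apply] using h y y'

/-- **Every operator is the (2.69)-kernel operator of its w-normalised matrix** (w ≠ 0): `K_w(mat T ∕ w) = T` — so a
hypothesis `kerOp w X = T` is a DEFINITION of the kernel X of T in the pairing (2.69), not a restriction on T.
[cite: Balaban1984PropagatorsII, (2.69) p.235] -/
theorem kerOp_mat_div (w : S → ℝ) (hw : ∀ y, w y ≠ 0) (T : Module.End ℝ (S → ℝ)) :
    kerOp w (fun y y'' => mat T y y'' / w y'') = T := by
  refine eq_of_mat_eq fun y y' => ?_
  rw [mat_kerOp, mul_div_cancel₀ _ (hw y')]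

/-- The weighted kernel difference is the matrix entry of the operator difference:
`w(y″)·(X̃(y,y″) − X(y,y″)) = mat(T̃ − T)(y,y″)` when `K_w(X) = T`, `K_w(X̃) = T̃`. [folklore] -/
theorem mat_kerOp_sub {w : S → ℝ} {X Xw : S → S → ℝ} {T Tw : Module.End ℝ (S → ℝ)}
    (hX : kerOp w X = T) (hXw : kerOp w Xw = Tw) (y y'' : S) :
    w y'' * (Xw y y'' - X y y'') = mat (Tw - T) y y'' := by
  rw [mat_sub, ← hX, ← hXw, mat_kerOp, mat_kerOp]
  ring

/-- **Item (b) of the dictionary**: `□(y)·w(y″)(X̃_□ − X)(y,y″)·h_□(y″) = entry(□·(T̃ − T)·h_□)(y,y″)` in the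
conventions of the fine chain (`B9Thm34Inv.entry`, `B9Thm37Sum.mulOp`). [folklore] -/
theorem sandwich_entry_eq {w : S → ℝ} {X Xw : S → S → ℝ} {T Tw : Module.End ℝ (S → ℝ)}
    (hX : kerOp w X = T) (hXw : kerOp w Xw = Tw) (p h : S → ℝ) (y y'' : S) :
    p y * (w y'' * (Xw y y'' - X y y'')) * h y'' =
      B9Thm34Inv.entry (B9Thm37Sum.mulOp p * (Tw - T) * B9Thm37Sum.mulOp h) y y'' := by
  rw [mat_kerOp_sub hX hXw, entry_eq_mat, mulOp_eq_mulOp, mulOp_eq_mulOp, mat_mul_mulOp, mat_mulOp_mul]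

end Dictionary

/-! ## §2  One cube: `hdom` from the fine-lattice line-3 chain -/

section OneCube

variable {g : B6.Geometry} [DecidableEq g.Site] {X : Type}

/-- **THE CHANGE-OF-DOMAIN INPUT OF PROP. 2.3 FOR ONE CUBE** (p. 238: *"the operator with G′(□̃)² − G′² is small and
an estimate has the factor e^{−δ₀M} because of the usual estimate of the type (1.12) [3] connected with a change of a
domain"*).  Under the located inputs of `B6DomainMajorantSandwichProfile.line3_term_entry_le_profile` for the cube's
data — blocks blk : X → 𝔅, (2.60) at α′ with L²e^{−α′δ₀RM} ≤ 1, an abstract (2.61) profile K, the zone N ≠ ∅ and the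
cut-off χ of □̃ with the cut algebra G′D = DG′ = 1, χDG′(□̃) = χ = G′(□̃)Dχ, the majorants G′, G′(□̃) ≺ B₁(L^jη)²e^{−δd},
(χD − Dχ)G′(□̃), (χD − Dχ)G′ ≺ θ1_N e^{−δd}, the cube □ = `pf` and h_□ = `hf` (|·| ≤ 1) inside χ = 1 at distance ≥ M₀
from N, Q′ ≺ c_Q1, Q′* ≺ c_{Q*}1 (c_Q, c_{Q*} ≥ 0) commuting with the cuts — together with the DICTIONARY
`kerOp w X = Q′G′²Q′*`, `kerOp w X̃_□ = Q′G′(□̃)²Q′*` (w = (L^{j″}η)^d) and the depth comparison `c₃M ≤ ((δ−α′δ₀)/3)M₀`: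
`|□(y)·w(y″)(X̃_□ − X)(y,y″)·h_□(y″)| ≤ (c_Qc_{Q*}L²C_tot)·e^{−c₃M}·(L^jη)⁴·e^{−½((δ−α′δ₀)/3)d(y,y″)}` — the binder `hdom`
of `B6Prop23Assembled.prop23_assembled` for this cube, at δ₀ := (δ − α′δ₀)/3.
[cite: Balaban1984PropagatorsII, p.238 before (2.85) + (2.82) line 3 p.237] -/
theorem hdom_of_line3 (blk : X → g.Site) (hρ : IsPseudoDist g.dist) {δ₀ α' : ℝ}
    (h260 : B6RandomWalk.Ineq260 g δ₀ α') {K : ℝ → ℝ} (hK : ∀ a, 0 < a → 0 ≤ K a)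
    (hPr : Profile g.dist (fun a : g.Site => a) K)
    (hα' : 0 ≤ α' * δ₀) (hRM : 0 ≤ g.R * g.M) (hL : 1 ≤ g.L)
    (hsize : g.L ^ 2 * Real.exp (-(α' * δ₀ * (g.R * g.M))) ≤ 1)
    (N : Finset g.Site) (hN : N.Nonempty)
    {δ B₁ θ : ℝ} (hκδ : α' * δ₀ < δ) (hB₁ : 0 ≤ B₁) (hθ : 0 ≤ θ)
    {G D Gw : Module.End ℝ (X → ℝ)} {χ : X → ℝ} {pf hf : g.Site → ℝ}
    (hχ1 : ∀ x, |χ x| ≤ 1) (hpf1 : ∀ y, |pf y| ≤ 1) (hh1 : ∀ y, |hf y| ≤ 1)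
    (hpfχ : ∀ x, pf (blk x) * χ x = pf (blk x)) (hhχ : ∀ x, χ x * hf (blk x) = hf (blk x))
    (hχN : ∀ x, blk x ∉ N → χ x = 1)
    (hGD : G * D = 1) (hDG : D * G = 1)
    (hχGw : B9Thm37Sum.mulOp χ * D * Gw = B9Thm37Sum.mulOp χ)
    (hGwχ : Gw * D * B9Thm37Sum.mulOp χ = B9Thm37Sum.mulOp χ)
    (hG : HasMajorant blk G (fun a b => B₁ * g.len a ^ 2 * Real.exp (-(δ * g.dist a b))))
    (hGw : HasMajorant blk Gw (fun a b => B₁ * g.len a ^ 2 * Real.exp (-(δ * g.dist a b))))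
    (hKGw : HasMajorant blk ((B9Thm37Sum.mulOp χ * D - D * B9Thm37Sum.mulOp χ) * Gw)
      (fun a b => (if a ∈ N then θ else 0) * Real.exp (-(δ * g.dist a b))))
    (hKG : HasMajorant blk ((B9Thm37Sum.mulOp χ * D - D * B9Thm37Sum.mulOp χ) * G)
      (fun a b => (if a ∈ N then θ else 0) * Real.exp (-(δ * g.dist a b))))
    {M₀ : ℝ} (hpfdeep : ∀ y, pf y ≠ 0 → ∀ n ∈ N, M₀ ≤ g.dist y n)
    (hhdeep : ∀ y, hf y ≠ 0 → ∀ n ∈ N, M₀ ≤ g.dist y n)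
    {Qp : (X → ℝ) →ₗ[ℝ] (g.Site → ℝ)} {Qs : (g.Site → ℝ) →ₗ[ℝ] (X → ℝ)} {cQ cQs : ℝ} (hcQ : 0 ≤ cQ)
    (hcQs : 0 ≤ cQs)
    (hQ : HasMajorantHom blk (fun y : g.Site => y) Qp (fun (a b : g.Site) => cQ * (if a = b then (1 : ℝ) else 0)))
    (hQs : HasMajorantHom (fun y : g.Site => y) blk Qs (fun (a b : g.Site) => cQs * (if a = b then (1 : ℝ) else 0)))
    (hQχ : (B9Thm37Sum.mulOp pf : Module.End ℝ (g.Site → ℝ)) ∘ₗ Qp =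
      Qp ∘ₗ (B9Thm37Sum.mulOp (pf ∘ blk) : Module.End ℝ (X → ℝ)))
    (hQsh : Qs ∘ₗ (B9Thm37Sum.mulOp hf : Module.End ℝ (g.Site → ℝ)) =
      (B9Thm37Sum.mulOp (hf ∘ blk) : Module.End ℝ (X → ℝ)) ∘ₗ Qs)
    (d : ℕ) {Xk Xwk : g.Site → g.Site → ℝ}
    (hX : kerOp (fun z => g.len z ^ d) Xk = Qp ∘ₗ (G * G) ∘ₗ Qs)
    (hXw : kerOp (fun z => g.len z ^ d) Xwk = Qp ∘ₗ (Gw * Gw) ∘ₗ Qs)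
    {c₃ : ℝ} (hM₀ : c₃ * g.M ≤ (δ - α' * δ₀) / 3 * M₀) (y y'' : g.Site) :
    |pf y * (g.len y'' ^ d * (Xwk y y'' - Xk y y'')) * hf y''| ≤
      (cQ * cQs * (g.L ^ 2 * Ctot K B₁ θ (δ - α' * δ₀))) * Real.exp (-(c₃ * g.M)) * g.len y ^ 4 *
        Real.exp (-(1 / 2 * ((δ - α' * δ₀) / 3) * g.dist y y'')) := by
  have hop : Qp ∘ₗ (Gw * Gw) ∘ₗ Qs - Qp ∘ₗ (G * G) ∘ₗ Qs = Qp ∘ₗ (Gw * Gw - G * G) ∘ₗ Qs := by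
    rw [LinearMap.sub_comp, LinearMap.comp_sub]
  have hentry := sandwich_entry_eq hX hXw pf hf y y''
  rw [hop] at hentry
  rw [hentry]
  have hle := line3_term_entry_le_profile blk hρ h260 hK hPr hα' hRM hL hsize N hN hκδ hB₁ hθ hχ1 hpf1 hh1 hpfχ hhχ
    hχN hGD hDG hχGw hGwχ hG hGw hKGw hKG hpfdeep hhdeep hcQs hQ hQs hQχ hQsh y y''
  refine hle.trans ?_
  have hC : 0 ≤ Ctot K B₁ θ (δ - α' * δ₀) := Ctot_nonneg hK hB₁ hθ (sub_pos.mpr hκδ)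
  have hL2 : 0 ≤ g.L ^ 2 := pow_nonneg (le_trans zero_le_one hL) 2
  have hexpM : Real.exp (-((δ - α' * δ₀) / 3 * M₀)) ≤ Real.exp (-(c₃ * g.M)) :=
    Real.exp_le_exp.mpr (neg_le_neg hM₀)
  have hrate : Real.exp (-((δ - α' * δ₀) / 3 / 2 * g.dist y y'')) =
      Real.exp (-(1 / 2 * ((δ - α' * δ₀) / 3) * g.dist y y'')) := by
    congr 1; ring
  have hlen4 : (g.len y ^ 2) ^ 2 = g.len y ^ 4 := by ring
  rw [hrate, hlen4]
  have hA : 0 ≤ cQ * cQs * (g.L ^ 2 * g.len y ^ 4 * Ctot K B₁ θ (δ - α' * δ₀)) := by positivity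
  calc cQ * cQs * (g.L ^ 2 * g.len y ^ 4 * Ctot K B₁ θ (δ - α' * δ₀) * Real.exp (-((δ - α' * δ₀) / 3 * M₀)) *
          Real.exp (-(1 / 2 * ((δ - α' * δ₀) / 3) * g.dist y y'')))
      = cQ * cQs * (g.L ^ 2 * g.len y ^ 4 * Ctot K B₁ θ (δ - α' * δ₀)) * Real.exp (-((δ - α' * δ₀) / 3 * M₀)) *
          Real.exp (-(1 / 2 * ((δ - α' * δ₀) / 3) * g.dist y y'')) := by ring
    _ ≤ cQ * cQs * (g.L ^ 2 * g.len y ^ 4 * Ctot K B₁ θ (δ - α' * δ₀)) * Real.exp (-(c₃ * g.M)) *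
          Real.exp (-(1 / 2 * ((δ - α' * δ₀) / 3) * g.dist y y'')) :=
        mul_le_mul_of_nonneg_right (mul_le_mul_of_nonneg_left hexpM hA) (Real.exp_nonneg _)
    _ = _ := by ring

end OneCube

/-! ## §3  The family over the cubes: literally the binder `hdom` of `prop23_assembled` -/

section Family

variable {g : B6.Geometry} [DecidableEq g.Site] {X : Type} {ι : Type}

/-- **THE CHANGE-OF-DOMAIN INPUT `hdom` OF `B6Prop23Assembled.prop23_assembled`, ALL CUBES**: for a family of cubes
i (□_i = `pf i`, h_{□_i} = `hf i`, each with its zone N_i ≠ ∅, cut-off χ_i, D_i and G′(□̃_i) = `Gw i`; the fine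
lattice, the blocks, G′, Q′, Q′*, the constants and the depth M₀ common), the per-cube located inputs of the line-3
chain and the dictionary `kerOp w X = Q′G′²Q′*`, `kerOp w (X̃ i) = Q′G′(□̃_i)²Q′*` give
`∀ i y y″, |pf i y * (len y″ ^ d * (Xw i y y″ − X y y″)) * hf i y″| ≤ B_D·e^{−c₃M}·(len y)⁴·e^{−½δ₀_asm·d(y,y″)}`
with B_D = c_Qc_{Q*}L²C_tot K B₁ θ (δ − α′δ₀) and δ₀_asm = (δ − α′δ₀)/3 — the hypothesis `hdom` of `prop23_assembled`
instantiated at that δ₀, by name. [cite: Balaban1984PropagatorsII, p.238 before (2.85) + (2.82) line 3 p.237] -/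
theorem hdom_family (blk : X → g.Site) (hρ : IsPseudoDist g.dist) {δ₀ α' : ℝ}
    (h260 : B6RandomWalk.Ineq260 g δ₀ α') {K : ℝ → ℝ} (hK : ∀ a, 0 < a → 0 ≤ K a)
    (hPr : Profile g.dist (fun a : g.Site => a) K)
    (hα' : 0 ≤ α' * δ₀) (hRM : 0 ≤ g.R * g.M) (hL : 1 ≤ g.L)
    (hsize : g.L ^ 2 * Real.exp (-(α' * δ₀ * (g.R * g.M))) ≤ 1)
    (N : ι → Finset g.Site) (hN : ∀ i, (N i).Nonempty)
    {δ B₁ θ : ℝ} (hκδ : α' * δ₀ < δ) (hB₁ : 0 ≤ B₁) (hθ : 0 ≤ θ)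
    {G : Module.End ℝ (X → ℝ)} {D Gw : ι → Module.End ℝ (X → ℝ)} {χ : ι → X → ℝ} {pf hf : ι → g.Site → ℝ}
    (hχ1 : ∀ i x, |χ i x| ≤ 1) (hpf1 : ∀ i y, |pf i y| ≤ 1) (hh1 : ∀ i y, |hf i y| ≤ 1)
    (hpfχ : ∀ i x, pf i (blk x) * χ i x = pf i (blk x)) (hhχ : ∀ i x, χ i x * hf i (blk x) = hf i (blk x))
    (hχN : ∀ i x, blk x ∉ N i → χ i x = 1)
    (hGD : ∀ i, G * D i = 1) (hDG : ∀ i, D i * G = 1)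
    (hχGw : ∀ i, B9Thm37Sum.mulOp (χ i) * D i * Gw i = B9Thm37Sum.mulOp (χ i))
    (hGwχ : ∀ i, Gw i * D i * B9Thm37Sum.mulOp (χ i) = B9Thm37Sum.mulOp (χ i))
    (hG : HasMajorant blk G (fun a b => B₁ * g.len a ^ 2 * Real.exp (-(δ * g.dist a b))))
    (hGw : ∀ i, HasMajorant blk (Gw i) (fun a b => B₁ * g.len a ^ 2 * Real.exp (-(δ * g.dist a b))))
    (hKGw : ∀ i, HasMajorant blk ((B9Thm37Sum.mulOp (χ i) * D i - D i * B9Thm37Sum.mulOp (χ i)) * Gw i)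
      (fun a b => (if a ∈ N i then θ else 0) * Real.exp (-(δ * g.dist a b))))
    (hKG : ∀ i, HasMajorant blk ((B9Thm37Sum.mulOp (χ i) * D i - D i * B9Thm37Sum.mulOp (χ i)) * G)
      (fun a b => (if a ∈ N i then θ else 0) * Real.exp (-(δ * g.dist a b))))
    {M₀ : ℝ} (hpfdeep : ∀ i y, pf i y ≠ 0 → ∀ n ∈ N i, M₀ ≤ g.dist y n)
    (hhdeep : ∀ i y, hf i y ≠ 0 → ∀ n ∈ N i, M₀ ≤ g.dist y n)
    {Qp : (X → ℝ) →ₗ[ℝ] (g.Site → ℝ)} {Qs : (g.Site → ℝ) →ₗ[ℝ] (X → ℝ)} {cQ cQs : ℝ} (hcQ : 0 ≤ cQ)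
    (hcQs : 0 ≤ cQs)
    (hQ : HasMajorantHom blk (fun y : g.Site => y) Qp (fun (a b : g.Site) => cQ * (if a = b then (1 : ℝ) else 0)))
    (hQs : HasMajorantHom (fun y : g.Site => y) blk Qs (fun (a b : g.Site) => cQs * (if a = b then (1 : ℝ) else 0)))
    (hQχ : ∀ i, (B9Thm37Sum.mulOp (pf i) : Module.End ℝ (g.Site → ℝ)) ∘ₗ Qp =
      Qp ∘ₗ (B9Thm37Sum.mulOp (pf i ∘ blk) : Module.End ℝ (X → ℝ)))
    (hQsh : ∀ i, Qs ∘ₗ (B9Thm37Sum.mulOp (hf i) : Module.End ℝ (g.Site → ℝ)) =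
      (B9Thm37Sum.mulOp (hf i ∘ blk) : Module.End ℝ (X → ℝ)) ∘ₗ Qs)
    (d : ℕ) {Xk : g.Site → g.Site → ℝ} {Xwk : ι → g.Site → g.Site → ℝ}
    (hX : kerOp (fun z => g.len z ^ d) Xk = Qp ∘ₗ (G * G) ∘ₗ Qs)
    (hXw : ∀ i, kerOp (fun z => g.len z ^ d) (Xwk i) = Qp ∘ₗ (Gw i * Gw i) ∘ₗ Qs)
    {c₃ : ℝ} (hM₀ : c₃ * g.M ≤ (δ - α' * δ₀) / 3 * M₀) :
    ∀ i y y'', |pf i y * (g.len y'' ^ d * (Xwk i y y'' - Xk y y'')) * hf i y''| ≤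
      (cQ * cQs * (g.L ^ 2 * Ctot K B₁ θ (δ - α' * δ₀))) * Real.exp (-(c₃ * g.M)) * g.len y ^ 4 *
        Real.exp (-(1 / 2 * ((δ - α' * δ₀) / 3) * g.dist y y'')) :=
  fun i y y'' => hdom_of_line3 blk hρ h260 hK hPr hα' hRM hL hsize (N i) (hN i) hκδ hB₁ hθ (hχ1 i) (hpf1 i) (hh1 i)
    (hpfχ i) (hhχ i) (hχN i) (hGD i) (hDG i) (hχGw i) (hGwχ i) hG (hGw i) (hKGw i) (hKG i) (hpfdeep i) (hhdeep i) hcQ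
    hcQs hQ hQs (hQχ i) (hQsh i) d hX (hXw i) hM₀ y y''

end Family

/-! ## §4  Proposition 2.3 re-assembled with the change-of-domain input DISCHARGED from the fine chain -/

section Reassembly

variable {g : B6.Geometry} [DecidableEq g.Site] {X : Type} {ι : Type} [Fintype ι] [DecidableEq ι]

open B6Lemma21Repaired (Ineq261With Ineq263With)
open B6Expansion282 (locOp Cglued R282)
open B6Prop23Assembled (K285 prop23_assembled)

/-- |□| ≤ 1 for a {0,1}-valued characteristic function. [folklore] -/
theorem abs_le_one_of_zero_or_one {S : Type} {p : S → ℝ} (h : ∀ y, p y = 0 ∨ p y = 1) (y : S) : |p y| ≤ 1 := by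
  rcases h y with h0 | h1
  · rw [h0, abs_zero]; exact zero_le_one
  · rw [h1, abs_one]

omit [DecidableEq ι] in
/-- |h_□(y)| ≤ 1 from (2.36) Σ_□ h_□(y)² = 1. [cite: Balaban1984PropagatorsII, (2.36) p.230] -/
theorem abs_le_one_of_sum_sq {S : Type} {hf : ι → S → ℝ} (h236 : ∀ y, ∑ i, hf i y ^ 2 = 1) (i : ι) (y : S) :
    |hf i y| ≤ 1 := by
  have hle : hf i y ^ 2 ≤ ∑ i', hf i' y ^ 2 :=
    Finset.single_le_sum (f := fun i' => hf i' y ^ 2) (fun i' _ => sq_nonneg (hf i' y)) (Finset.mem_univ i)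
  rw [h236 y] at hle
  exact (sq_le_one_iff_abs_le_one (hf i y)).mp hle

/-- **PROPOSITION 2.3 ASSEMBLED, WITH THE CHANGE-OF-DOMAIN INPUT DISCHARGED** (p. 238 before (2.85) ⟹ (2.85) ⟹
Lemma 2.1 ⟹ (2.86)–(2.87)): `B6Prop23Assembled.prop23_assembled` at the rate δ₀ := (δ − α′δ₀)/3 and the constant
B_D := c_Qc_{Q*}L²C_tot K B₁ θ (δ − α′δ₀), its hypothesis `hdom` replaced by the located inputs of the fine-lattice
line-3 chain for every cube (`hdom_family`) and the dictionary `kerOp w X = Q′G′²Q′*`, `kerOp w X̃_□ = Q′G′(□̃)²Q′*`;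
`0 < δ₀`, `0 ≤ B_D`, `|□| ≤ 1`, `|h_□| ≤ 1`, (2.54) for 𝔅 discharged here from `hκδ`, the nonnegativities, `hpf01`,
`h236`, `hρ`.  Conclusion verbatim that of `prop23_assembled`: the two-sided inverse G = (Q′G′²Q′*)^{−1} in the
pairing (2.69), the expansion identity (2.86) G = C + G·R, uniqueness, and the bound (2.87)
`|G(y,y′)(L^{j′}η)^{−d}| ≤ 2n₀B_C L^{d+4}c·(L^jη)^{−4}(L^{j′}η)^{−d}e^{−(δ₁/2)d(y,y′)}`.  EVERY analytic input of B6
Sect. B other than the change-of-domain algebra stays a located hypothesis ((2.60), the (2.61) profile and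
`Ineq261With`/`Ineq263With`, the majorants (2.67)₁-type of G′, G′(□̃) and of the commutator products, (2.68) for X and
X̃_□ as `hX`/`hXw`, (2.81) as `h281`, (2.70)/(2.36) as `h270`/`h236`, the threshold «M large enough» as `hKM`, the depth
comparison `hM₀`). [cite: Balaban1984PropagatorsII, Proposition 2.3 (2.85)–(2.87) p.238] -/
theorem prop23_assembled_fine (d : ℕ) (hρ : IsPseudoDist g.dist) (hsep : B6Ineq268.LevelSep g) (hL : 1 ≤ g.L)
    (hη : 0 < g.eta) (hM : 0 < g.M) (hRM : 0 ≤ g.R * g.M)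
    -- the fine-lattice side: blocks, (2.60), the (2.61) profile, the located size condition
    (blk : X → g.Site) {δ₀ α' : ℝ} (h260 : B6RandomWalk.Ineq260 g δ₀ α') {K : ℝ → ℝ}
    (hK : ∀ a, 0 < a → 0 ≤ K a) (hPr : Profile g.dist (fun a : g.Site => a) K) (hα' : 0 ≤ α' * δ₀)
    (hsize : g.L ^ 2 * Real.exp (-(α' * δ₀ * (g.R * g.M))) ≤ 1)
    {δ B₁ θ : ℝ} (hκδ : α' * δ₀ < δ) (hB₁ : 0 ≤ B₁) (hθ : 0 ≤ θ)
    -- the constants of the assembled Prop. 2.3 (its δ₀ is (δ − α′δ₀)/3 here)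
    {δ₁ σ cσ c c₃ s mg BX BC : ℝ} (hδ₁ : 0 ≤ δ₁) (hsplit : δ₁ + σ * ((δ - α' * δ₀) / 3) ≤ (δ - α' * δ₀) / 3 / 4)
    (h261σ : Ineq261With cσ g ((δ - α' * δ₀) / 3) σ)
    (hthr : g.L ^ 4 ≤ Real.exp (1 / 8 * ((δ - α' * δ₀) / 3) * g.R * g.M))
    (h261 : Ineq261With c g δ₁ (1 / 2)) (h263 : Ineq263With c g δ₁ (1 / 2)) (hc : 0 ≤ c)
    (hc₃ : 0 < c₃) (hs : 0 ≤ s) (hmg : 0 < mg) (hBX : 0 ≤ BX) (hBC : 0 ≤ BC)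
    -- the cubes □_i = pf i, the partition of unity h_i = hf i, the kernels X, X̃_i, C_i in the pairing (2.69)
    {pf hf : ι → g.Site → ℝ} {js : ι → ℕ} {n₀ : ℕ} {Xk : g.Site → g.Site → ℝ}
    {Xwk Ck : ι → g.Site → g.Site → ℝ}
    (hover : ∀ y, (Finset.univ.filter fun i => hf i y ≠ 0).card ≤ n₀)
    (hpf01 : ∀ i y, pf i y = 0 ∨ pf i y = 1) (hph : ∀ i y, pf i y * hf i y = hf i y)
    (h236 : ∀ y, ∑ i, hf i y ^ 2 = 1) (hLip : ∀ i y y'', |hf i y - hf i y''| ≤ s / g.M * g.dist y y'')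
    (hcube : ∀ i y, pf i y ≠ 0 → js i ≤ g.scale y ∧ g.scale y ≤ js i + 1)
    (hlev : ∀ i y y', hf i y ≠ 0 → hf i y' ≠ 0 → g.scale y = g.scale y')
    (hgap : ∀ i y y'', pf i y = 0 → hf i y'' ≠ 0 → mg * g.M ≤ g.dist y y'')
    (hX : ∀ y y'', |g.len y'' ^ d * Xk y y''| ≤
      BX * g.len y ^ 4 * Real.exp (-(1 / 2 * ((δ - α' * δ₀) / 3) * g.dist y y'')))
    (hXw : ∀ i y y'', |g.len y'' ^ d * Xwk i y y''| ≤
      BX * g.len y ^ 4 * Real.exp (-(1 / 2 * ((δ - α' * δ₀) / 3) * g.dist y y'')))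
    (h281 : ∀ i y y', pf i y ≠ 0 → pf i y' ≠ 0 →
      |Ck i y y'| ≤ BC / (g.L ^ js i * g.eta) ^ (d + 4) * Real.exp (-(δ₁ * g.dist y y')))
    (hCk0 : ∀ i y'' y', pf i y'' = 0 → Ck i y'' y' = 0)
    (h270 : ∀ i, locOp (fun i => B6Expansion282.mulOp (pf i)) (fun i => kerOp (fun z => g.len z ^ d) (Xwk i)) i *
      kerOp (fun z => g.len z ^ d) (Ck i) * B6Expansion282.mulOp (hf i) = B6Expansion282.mulOp (hf i))
    -- the fine-lattice data of each cube: zone N_i, cut-off χ_i, D_i, G′(□̃_i) = Gw i; G′ = G, Q′ = Qp, Q′* = Qs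
    (N : ι → Finset g.Site) (hN : ∀ i, (N i).Nonempty)
    {G : Module.End ℝ (X → ℝ)} {Dop Gw : ι → Module.End ℝ (X → ℝ)} {χ : ι → X → ℝ}
    (hχ1 : ∀ i x, |χ i x| ≤ 1)
    (hpfχ : ∀ i x, pf i (blk x) * χ i x = pf i (blk x)) (hhχ : ∀ i x, χ i x * hf i (blk x) = hf i (blk x))
    (hχN : ∀ i x, blk x ∉ N i → χ i x = 1)
    (hGD : ∀ i, G * Dop i = 1) (hDG : ∀ i, Dop i * G = 1)
    (hχGw : ∀ i, B9Thm37Sum.mulOp (χ i) * Dop i * Gw i = B9Thm37Sum.mulOp (χ i))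
    (hGwχ : ∀ i, Gw i * Dop i * B9Thm37Sum.mulOp (χ i) = B9Thm37Sum.mulOp (χ i))
    (hG : HasMajorant blk G (fun a b => B₁ * g.len a ^ 2 * Real.exp (-(δ * g.dist a b))))
    (hGw : ∀ i, HasMajorant blk (Gw i) (fun a b => B₁ * g.len a ^ 2 * Real.exp (-(δ * g.dist a b))))
    (hKGw : ∀ i, HasMajorant blk ((B9Thm37Sum.mulOp (χ i) * Dop i - Dop i * B9Thm37Sum.mulOp (χ i)) * Gw i)
      (fun a b => (if a ∈ N i then θ else 0) * Real.exp (-(δ * g.dist a b))))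
    (hKG : ∀ i, HasMajorant blk ((B9Thm37Sum.mulOp (χ i) * Dop i - Dop i * B9Thm37Sum.mulOp (χ i)) * G)
      (fun a b => (if a ∈ N i then θ else 0) * Real.exp (-(δ * g.dist a b))))
    {M₀ : ℝ} (hpfdeep : ∀ i y, pf i y ≠ 0 → ∀ n ∈ N i, M₀ ≤ g.dist y n)
    (hhdeep : ∀ i y, hf i y ≠ 0 → ∀ n ∈ N i, M₀ ≤ g.dist y n)
    {Qp : (X → ℝ) →ₗ[ℝ] (g.Site → ℝ)} {Qs : (g.Site → ℝ) →ₗ[ℝ] (X → ℝ)} {cQ cQs : ℝ} (hcQ : 0 ≤ cQ)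
    (hcQs : 0 ≤ cQs)
    (hQ : HasMajorantHom blk (fun y : g.Site => y) Qp (fun (a b : g.Site) => cQ * (if a = b then (1 : ℝ) else 0)))
    (hQs : HasMajorantHom (fun y : g.Site => y) blk Qs (fun (a b : g.Site) => cQs * (if a = b then (1 : ℝ) else 0)))
    (hQχ : ∀ i, (B9Thm37Sum.mulOp (pf i) : Module.End ℝ (g.Site → ℝ)) ∘ₗ Qp =
      Qp ∘ₗ (B9Thm37Sum.mulOp (pf i ∘ blk) : Module.End ℝ (X → ℝ)))
    (hQsh : ∀ i, Qs ∘ₗ (B9Thm37Sum.mulOp (hf i) : Module.End ℝ (g.Site → ℝ)) =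
      (B9Thm37Sum.mulOp (hf i ∘ blk) : Module.End ℝ (X → ℝ)) ∘ₗ Qs)
    -- the dictionary (definitions of X, X̃_i as the (2.69)-kernels of Q′G′²Q′*, Q′G′(□̃_i)²Q′*) and the depth
    (hXdef : kerOp (fun z => g.len z ^ d) Xk = Qp ∘ₗ (G * G) ∘ₗ Qs)
    (hXwdef : ∀ i, kerOp (fun z => g.len z ^ d) (Xwk i) = Qp ∘ₗ (Gw i * Gw i) ∘ₗ Qs)
    (hM₀ : c₃ * g.M ≤ (δ - α' * δ₀) / 3 * M₀)
    -- «M large enough», with B_D := c_Q c_{Q*} L² C_tot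
    (hKM : 2 * K285 g d n₀ s ((δ - α' * δ₀) / 3) cσ c₃ mg BX (cQ * cQs * (g.L ^ 2 * Ctot K B₁ θ (δ - α' * δ₀))) BC
      * c ≤ g.M) :
    ∃ Ginv : Module.End ℝ (g.Site → ℝ),
      Ginv * kerOp (fun z => g.len z ^ d) Xk = 1 ∧ kerOp (fun z => g.len z ^ d) Xk * Ginv = 1 ∧
      Ginv = Cglued (fun i => B6Expansion282.mulOp (hf i)) (fun i => kerOp (fun z => g.len z ^ d) (Ck i)) +
        Ginv * R282 (kerOp (fun z => g.len z ^ d) Xk) (fun i => B6Expansion282.mulOp (pf i))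
          (fun i => kerOp (fun z => g.len z ^ d) (Xwk i)) (fun i => B6Expansion282.mulOp (hf i))
          (fun i => kerOp (fun z => g.len z ^ d) (Ck i)) ∧
      (∀ G' : Module.End ℝ (g.Site → ℝ), G' * kerOp (fun z => g.len z ^ d) Xk = 1 → G' = Ginv) ∧
      ∀ y y', |mat Ginv y y' / g.len y' ^ d| ≤
        2 * (n₀ * (BC * g.L ^ (d + 4))) * c * g.len y ^ (-(4 : ℝ)) * g.len y' ^ (-(d : ℝ)) *
          Real.exp (-(δ₁ / 2 * g.dist y y')) := by
  have hδA : 0 < (δ - α' * δ₀) / 3 := by linarith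
  have hBD : 0 ≤ cQ * cQs * (g.L ^ 2 * Ctot K B₁ θ (δ - α' * δ₀)) :=
    mul_nonneg (mul_nonneg hcQ hcQs)
      (mul_nonneg (pow_nonneg (le_trans zero_le_one hL) 2) (Ctot_nonneg hK hB₁ hθ (sub_pos.mpr hκδ)))
  have hpf1 : ∀ i y, |pf i y| ≤ 1 := fun i => abs_le_one_of_zero_or_one (hpf01 i)
  have hh1 : ∀ i y, |hf i y| ≤ 1 := abs_le_one_of_sum_sq h236
  exact prop23_assembled d hρ.triangle hρ.zero hρ.nonneg hsep hL hη hM hRM hδA hδ₁ hsplit h261σ hthr h261 h263 hc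
    hc₃ hs hmg hBX hBD hBC hover hpf01 hph h236 hLip hcube hlev hgap hX hXw
    (hdom_family blk hρ h260 hK hPr hα' hRM hL hsize N hN hκδ hB₁ hθ hχ1 hpf1 hh1 hpfχ hhχ hχN hGD hDG hχGw hGwχ
      hG hGw hKGw hKG hpfdeep hhdeep hcQ hcQs hQ hQs hQχ hQsh d hXdef hXwdef hM₀)
    h281 hCk0 h270 hKM

end Reassembly

/-! ## §5  Consistency of the junction's hypothesis package: the one-point model -/

section NonVacuity

open B6Prop23Assembled (ptGeo ptGeo_len ptGeo_dist)

/-- On the one-point fine lattice the multiplication operator by 1 is the identity. [folklore] -/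
theorem mulOp_one_pt : (B9Thm37Sum.mulOp (fun _ : ptGeo.Site => (1 : ℝ)) : Module.End ℝ (ptGeo.Site → ℝ)) = 1 := by
  refine LinearMap.ext fun μ => funext fun y => ?_
  show (1 : ℝ) * μ y = μ y
  rw [one_mul]

/-- **NON-VACUITY OF THE ONE-CUBE JUNCTION `hdom_of_line3`**: every hypothesis holds simultaneously on the one-point
model (fine lattice = 𝔅 = {pt}, blocks = id, G′ = D = G′(□̃) = 1, χ = □ = h_□ = 1, N = {pt}, Q′ = Q′* = id,
c_Q = c_{Q*} = B₁ = K = 1, θ = 0, δ₀ = 1, α′ = 0, δ = 3, M₀ = c₃ = 0, X = X̃ = the unit kernel) — the term below is the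
theorem applied there with every hypothesis discharged, so `hdom_of_line3` is not an implication from `False`.  (The
re-assembly `prop23_assembled_fine` additionally needs c₃ > 0, hence a depth M₀ > 0, which no one-point carrier has;
its joint consistency needs two sites and is not modelled here.) [folklore] -/
theorem hdom_of_line3_pt (d : ℕ) (y y'' : ptGeo.Site) :
    |(1 : ℝ) * (ptGeo.len y'' ^ d * ((1 : ℝ) - 1)) * 1| ≤
      (1 * 1 * (ptGeo.L ^ 2 * Ctot (fun _ => 1) 1 0 (3 - 0 * 1))) * Real.exp (-(0 * ptGeo.M)) * ptGeo.len y ^ 4 *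
        Real.exp (-(1 / 2 * ((3 - 0 * 1) / 3) * ptGeo.dist y y'')) := by
  classical
  have hmul1 := mulOp_one_pt
  have hK1 : kerOp (fun z => ptGeo.len z ^ d) (fun _ _ : ptGeo.Site => (1 : ℝ)) =
      LinearMap.id ∘ₗ ((1 : Module.End ℝ (ptGeo.Site → ℝ)) * 1) ∘ₗ LinearMap.id := by
    refine LinearMap.ext fun μ => funext fun u => ?_
    cases u
    simp [kerOp_apply]
  have hmaj1 : HasMajorant (fun u : ptGeo.Site => u) (1 : Module.End ℝ (ptGeo.Site → ℝ))
      (fun a b => 1 * ptGeo.len a ^ 2 * Real.exp (-(3 * ptGeo.dist a b))) := by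
    intro y' μ B hμ x
    cases x; cases y'
    have hb := hμ.bound PUnit.unit rfl
    simpa using hb
  have hcomm0 : (B9Thm37Sum.mulOp (fun _ : ptGeo.Site => (1 : ℝ)) * (1 : Module.End ℝ (ptGeo.Site → ℝ)) -
      1 * B9Thm37Sum.mulOp (fun _ : ptGeo.Site => (1 : ℝ))) * 1 = 0 := by
    rw [hmul1]; simp
  have hmaj0 : HasMajorant (fun u : ptGeo.Site => u)
      ((B9Thm37Sum.mulOp (fun _ : ptGeo.Site => (1 : ℝ)) * (1 : Module.End ℝ (ptGeo.Site → ℝ)) -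
        1 * B9Thm37Sum.mulOp (fun _ : ptGeo.Site => (1 : ℝ))) * 1)
      (fun a b => (if a ∈ ({PUnit.unit} : Finset ptGeo.Site) then (0 : ℝ) else 0) *
        Real.exp (-(3 * ptGeo.dist a b))) := by
    rw [hcomm0]
    intro y' μ B hμ x
    simp
  have hQid : HasMajorantHom (fun u : ptGeo.Site => u) (fun u : ptGeo.Site => u)
      (LinearMap.id : (ptGeo.Site → ℝ) →ₗ[ℝ] (ptGeo.Site → ℝ))
      (fun (a b : ptGeo.Site) => 1 * (if a = b then (1 : ℝ) else 0)) := by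
    intro y' μ B hμ v
    cases v; cases y'
    have hb := hμ.bound PUnit.unit rfl
    simpa using hb
  exact hdom_of_line3 (g := ptGeo) (X := ptGeo.Site) (fun u => u) ⟨fun _ _ => rfl, fun _ => rfl, fun _ _ _ => by simp⟩
    (δ₀ := 1) (α' := 0) (fun _ _ => by simp) (K := fun _ => 1) (fun _ _ => zero_le_one)
    (fun a _ s => by simp) (by norm_num) (by simp) (by simp) (by simp)
    {PUnit.unit} ⟨PUnit.unit, Finset.mem_singleton_self _⟩ (δ := 3) (B₁ := 1) (θ := 0) (by norm_num) zero_le_one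
    le_rfl (G := 1) (D := 1) (Gw := 1) (χ := fun _ => 1) (pf := fun _ => 1) (hf := fun _ => 1)
    (fun _ => by simp) (fun _ => by simp) (fun _ => by simp) (fun _ => by simp) (fun _ => by simp)
    (fun _ _ => rfl) (mul_one 1) (mul_one 1) (by rw [hmul1]; simp) (by rw [hmul1]; simp) hmaj1 hmaj1 hmaj0 hmaj0
    (M₀ := 0) (fun _ _ _ _ => by simp) (fun _ _ _ _ => by simp)
    (Qp := LinearMap.id) (Qs := LinearMap.id) (cQ := 1) (cQs := 1) zero_le_one zero_le_one hQid hQid rfl rfl d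
    (Xk := fun _ _ => 1) (Xwk := fun _ _ => 1) hK1 hK1 (c₃ := 0) (by simp) y y''

end NonVacuity

end Literature.MathematicalPhysics.QuantumFieldTheory.Balaban1983to89.B6Prop23DomainInput
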